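import Summits.QuantumFields.YangMills.Theorems.UniversalDetectorHankelCeiling
import Summits.QuantumFields.YangMills.Theorems.UniversalDetectorHankelLongitudinal
import Summits.QuantumFields.YangMills.Theorems.UniversalDetectorHankelTightGlue
import Summits.QuantumFields.YangMills.Theorems.UniversalDetectorPlaneLimitExtraction
import Summits.QuantumFields.YangMills.Theorems.UniversalDetectorRigidity
import Summits.QuantumFields.YangMills.Theorems.UniversalDetectorTightOfPlaneTight
import Summits.QuantumFields.YangMills.Theorems.UniversalDetectorDetectorExists
import HarnessLib

/-!
# Crux `BalabanLadder.NT` (stmt-QuantumFields-19353) — LINE «transverse curvature» (ym-idea-8 g10-3), birth skeleton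

Registered on route `route-QuantumFields-UniversalDetector` (rev 7).  The line decides `NT` from THREE stubs, all of them
items of that route: the deciding crux `SchemeCurvatureLaws` (stmt-QuantumFields-24087: at one scheme `(r,a)` the
one-annulus diagonal EDGE ceiling, the transverse CURVATURE bound `a⁻²·(2K(s e₀) − K(s e₀+e_k) − K(s e₀−e_k)) ≤ M` of the
four diagonal rescaled plane kernels at far time-axis lags, and NONCONTACT), the residual crux `SkewAtScheme`
(stmt-QuantumFields-26596, clause (ii) of `LowerBounds`), and the support `CurvatureEdgeGlue` (stmt-QuantumFields-24088:
`SchemeCurvatureLaws → HankelCeiling → SchemeEdgeLaws`, PROOF FILED p697426 `universalDetector_curvatureEdgeGlue`; it is a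
stub here only until that proposal lands).  Everything else the route's `closes` consumes is already a theorem in the tree
and is cited BY NAME in `NT_of`: `universalDetector_hankelCeiling`, `universalDetector_hankelLongitudinal`,
`hankelTightGlue_proof`, `detectorRigidity`, `planeLimitExtraction`, `universalDetector_detectorExists`, `tightOfPlaneTight`.
No summit, rung or crux is proved by this file.
-/

namespace Summit.QuantumFields.YangMills.Cruxes.NT.TransverseCurvature

open Summit.QuantumFields.YangMills.Theses.UniversalDetector

/-- STUB (deciding crux, stmt-QuantumFields-24087): the curvature laws at one scheme. -/
theorem stub_schemeCurvatureLaws : SchemeCurvatureLaws := by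
  sorry

/-- STUB (residual crux, stmt-QuantumFields-26596): clause (ii) of `LowerBounds` at every plane-tight scheme. -/
theorem stub_skewAtScheme : SkewAtScheme := by
  sorry

/-- STUB (support, stmt-QuantumFields-24088; proof filed as p697426 `universalDetector_curvatureEdgeGlue`):
BDD ∧ CURV ⇒ TRANS by reflection-positivity Cauchy–Schwarz with a difference observable. -/
theorem stub_curvatureEdgeGlue : CurvatureEdgeGlue := by
  sorry

/-- The line concludes the crux `NT` BY NAME: the three stubs and the seven landed item proofs feed the route's
deciding theorem `UniversalDetector.closes`. -/
theorem NT_of : SchemeCurvatureLaws → SkewAtScheme → CurvatureEdgeGlue →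
    Summit.QuantumFields.YangMills.Theses.BalabanLadder.NT := fun hK h5 hT =>
  closes hK hT
    Summit.QuantumFields.YangMills.Cruxes.UniversalDetectorHankel.universalDetector_hankelCeiling
    Summit.QuantumFields.YangMills.Cruxes.UniversalDetectorHankel.universalDetector_hankelLongitudinal
    Summit.QuantumFields.YangMills.Theorems.hankelTightGlue_proof
    Summit.QuantumFields.YangMills.Cruxes.DetectorRigidity.detectorRigidity
    Summit.QuantumFields.YangMills.Cruxes.UniversalDetectorPlaneTight.planeLimitExtraction
    Summit.QuantumFields.YangMills.Theorems.universalDetector_detectorExists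
    h5
    Summit.QuantumFields.YangMills.Cruxes.UniversalDetectorPlaneTight.tightOfPlaneTight

/-- `NT` from the stubs (kernel-checked composition). -/
theorem NT_of_stubs : Summit.QuantumFields.YangMills.Theses.BalabanLadder.NT :=
  NT_of stub_schemeCurvatureLaws stub_skewAtScheme stub_curvatureEdgeGlue

end Summit.QuantumFields.YangMills.Cruxes.NT.TransverseCurvature
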